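import Mathlib.RingTheory.Flat.EquationalCriterion
import Mathlib.RingTheory.AdicCompletion.Basic
import Mathlib.RingTheory.MvPowerSeries.Basic
import Mathlib.RingTheory.Ideal.Quotient.Operations
import Mathlib.LinearAlgebra.Matrix.Determinant.Basic
import Mathlib.RingTheory.LocalRing.Module
import Mathlib.RingTheory.Artinian.Ring
import Mathlib.RingTheory.Nakayama
import HarnessLib

/-!
# STUB-IDEAS companion — `stub_liftThree` — ideator k1 (FAMILY 1: recognise & import) — GEN 10

Plan 6 of `Cruxes/FreyModularity/STUB-IDEAS-stub_liftThree-1.md` (gen 10): the **de Smit–Brochard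
freeness criterion** — Taylor–Wiles at ONE auxiliary level `Q`, with NO patching and NO Taylor–Wiles
system (S. Brochard, *Proof of de Smit's conjecture: a freeness criterion*, Compos. Math. 153 (2017),
Thm. 1, Lemma 4 and §3 Thm. 9 / Lemma 10 / Remark 11 [arXiv:1607.02044]; M-independence background:
Brochard, J. Algebra 2023 [arXiv:2204.07006]; Wiebe's criterion: Bruns–Herzog Thm. 2.3.16,
Simon–Strooker arXiv:math/0703880 Thm. 2.4 / Cor. 2.7).  It REPLACES the patching-output algebra of
k2 g5 (`PatchedStage`, A1–A4) and removes the growth condition `n^(n-1) d^n < p^m` of k2 g2's DRS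
Criterion II engine: one TW set `Q` of primes `q ≡ 1 (mod 3)` suffices.

The file types the COMMUTATIVE-ALGEBRA ENGINE only (the number-theory inputs — TW primes with the
Selmer bound `edim R̄_Q ≤ #Q`, `H̄` free over `k[Δ_Q]`, augmentation control, the `Σ`-step — are the
companions' k3 g4, k1 g9, k2 g7/8 by reference).  Variant 6B ("Artinian de Smit + fibre generation")
keeps every ring finite-dimensional over `k` except the presentation `k[[X₁,…,X_r]] ↠ R̄_Q`.
Every `sorry` is an offered helper lemma (sizes in the .md); §0 items and `wiebeArtin_of_wiebeCriterion`
are proved.  Nothing here restates the stub, the crux or the summit.  Namespace is this file's own.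
-/

noncomputable section

open Function IsLocalRing

namespace Summit.ABC.ABC.Cruxes.FreyModularity.StubIdeas1g10

universe u v w

/-- The tree's `Literature.RingTheory.CompleteIntersection.IsCompleteIntersectionOver O T`
(de Smit–Rubin–Schoof: `T ≃ₐ[O] O[[X₁,…,X_n]]/(f₁,…,f_n)`), UNFOLDED verbatim so that this workfile
does not depend on the (currently rebuilding) `NumericalCriterion` module; a prover states results with
the tree's name. -/
def IsCIOver (O : Type u) (T : Type w) [CommRing O] [CommRing T] [Algebra O T] : Prop :=
  ∃ (n : ℕ) (f : Fin n → MvPowerSeries (Fin n) O),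
    Nonempty ((MvPowerSeries (Fin n) O ⧸ Ideal.span (Set.range f)) ≃ₐ[O] T)

/-! ## §1  Lech / Brochard `M`-independence (Brochard 2017 Lemma 4 (ii); Brochard 2023 Def. 5) -/

/-- **B1.** The sequence `x` is `M`-independent (in Lech's sense): every relation `∑ xᵢ mᵢ = 0` in `M`
has all its coefficients in `J_x M`, `J_x = (x₁, …, x_n)`.  [Brochard2017, Lemma 4 (ii);
Brochard2023, Def. 5] -/
def LechIndependent {B : Type*} [CommRing B] {ι : Type*} [Fintype ι] (x : ι → B)
    (M : Type*) [AddCommGroup M] [Module B M] : Prop :=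
  ∀ m : ι → M, ∑ i, x i • m i = 0 → ∀ i, m i ∈ Ideal.span (Set.range x) • (⊤ : Submodule B M)

/-- **B2 (size S).** If `M` is FLAT over the local ring `A` (through `A → B`) and `x₁, …, x_n` is a
MINIMAL system of generators of `𝔪_A` (typed as: every `A`-linear relation among the `xᵢ` has
coefficients in `𝔪_A`), then the images of the `xᵢ` in `B` are `M`-independent.  Proof: Mathlib's
equational criterion `Module.Flat.isTrivialRelation_of_sum_smul_eq_zero` writes `mᵢ = ∑ⱼ aᵢⱼ yⱼ` with
`∑ᵢ xᵢ aᵢⱼ = 0`, and minimality puts every `aᵢⱼ` in `𝔪_A = J_x`.  (For `M` FREE over `A` — the case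
used, `H̄` free over `k[Δ_Q]` — expand on a basis instead.)  [Brochard2017, proof of Thm. 1, "(ii)
holds by [BM] because `M` is flat over `A`"; Brochard2023 Prop. 11] -/
theorem lechIndependent_of_flat {A B M : Type*} [CommRing A] [IsLocalRing A] [CommRing B]
    [Algebra A B] [AddCommGroup M] [Module B M] [Module A M] [IsScalarTower A B M]
    [Module.Flat A M] {n : ℕ} (x : Fin n → A)
    (hmin : ∀ a : Fin n → A, ∑ i, a i * x i = 0 → ∀ i, a i ∈ maximalIdeal A)
    (hspan : Ideal.span (Set.range x) = maximalIdeal A) :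
    LechIndependent (fun i => algebraMap A B (x i)) M := by
  sorry

/-! ## §2  The heart: Brochard's determinant lemma (2017, Lemma 4) and `Δ ∉ 𝔪_A B` -/

/-- **B3 (size M; the heart, "hard elementary").**  `x = W u` (so `J_x ⊆ J_u`), `x` `M`-independent,
`Δ = det W`.  Then `Δ m ∈ J_x M ⟹ m ∈ J_u M`.  Brochard's proof is an induction `(A_ℓ)`, `0 ≤ ℓ ≤ n`,
on the minors `Δ^{E_ℓ}_I` of `W` (Laplace expansion along a column + the alternating-sign
cancellation `S(i,j) = -S(j,i)`); `(A_0)` is the hypothesis, `(A_n)` the conclusion since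
`Δ^{E_n}_{E_n} = 1`.  Mathlib: `Matrix.det_succ_column`, `Matrix.submatrix`, `Matrix.adjugate`; tree (Cramer step
`det W · uₖ ∈ (x)`): `Literature.RingTheory.CompleteIntersection.det_mul_mem_span_of_mulVec_eq`.
The case `n = 1` reads: `x = c u`, `c m = x m' ⟹ x (m' ) = c m`, i.e. `c (m - u m') = 0` … (use (ii)
for the relation `x · (m'') = 0`).  [Brochard2017, Lemma 4, pp. 3–4] -/
theorem brochard_lemma4 {B M : Type*} [CommRing B] [AddCommGroup M] [Module B M] {n : ℕ}
    (x u : Fin n → B) (W : Matrix (Fin n) (Fin n) B) (hW : ∀ i, x i = ∑ j, W i j * u j)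
    (hx : LechIndependent x M) {m : M}
    (hm : W.det • m ∈ Ideal.span (Set.range x) • (⊤ : Submodule B M)) :
    m ∈ Ideal.span (Set.range u) • (⊤ : Submodule B M) := by
  sorry

/-- **B4 (size S, from B3 + Nakayama).**  In the situation of B3 with `B` local, `J_u ⊆ 𝔪_B`, and `M`
a NON-ZERO finite `B`-module: `Δ = det W ∉ J_x`.  (Else `Δ M ⊆ J_x M`, so `M = 𝔪_B M` by B3, so
`M = 0` by `Submodule.eq_bot_of_le_smul_of_le_jacobson_bot`.)  Consequences recorded in the .md:
`edim B = n` and, in `B̄ = B ⧸ J_x`, `W̄ ū = 0` with `det W̄ ≠ 0` — a Wiebe matrix.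
[Brochard2017, proof of Thm. 1, "Then `Δ ∉ 𝔪_A B`, otherwise …"] -/
theorem det_notMem_span_of_lechIndependent {B M : Type*} [CommRing B] [IsLocalRing B]
    [AddCommGroup M] [Module B M] [Module.Finite B M] [Nontrivial M] {n : ℕ}
    (x u : Fin n → B) (W : Matrix (Fin n) (Fin n) B) (hW : ∀ i, x i = ∑ j, W i j * u j)
    (hu : ∀ j, u j ∈ maximalIdeal B) (hx : LechIndependent x M) :
    W.det ∉ Ideal.span (Set.range x) := by
  sorry

/-! ## §3  Wiebe's criterion (the one imported deep brick) -/

/-- **B5 (named fact; Wiebe 1969 Satz 1 = Bruns–Herzog Thm. 2.3.16 = Simon–Strooker Thm. 2.4 (iii)⇒(a),(b)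
/ Cor. 2.7), in coordinates.**  `θ : k[[X₁,…,X_n]] ↠ R` a surjection onto a local ring (so `uⱼ = θ(Xⱼ)`
generate `𝔪_R` and `R ⧸ 𝔪_R = k`), `W` an `n × n` matrix over `k[[X]]` whose rows are relations among the
`uⱼ` (`θ(∑ⱼ Wᵢⱼ Xⱼ) = 0`) and whose determinant survives (`θ(det W) ≠ 0`).  Then `ker θ` is GENERATED BY
THE `n` ROWS `aᵢ = ∑ⱼ Wᵢⱼ Xⱼ` (so `R ≅ k[[X]]/(a₁,…,a_n)` is a complete intersection of dimension zero) and
the socle `Ann_R(𝔪_R)` is `(θ(det W))`.  Proof in print: perturb `a` to a regular sequence modulo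
`𝔪^p` (BH Ex. 2.3.17), compare determinants, Krull intersection; Tate's socle theorem (IN THE TREE over
a field: `Literature.RingTheory.CompleteIntersection.span_det_le_of_ne_bot`,
`annihilator_map_idealOfVars_eq_span_det`, `det_notMem_span_of_mem`).  [BrunsHerzog Thm. 2.3.16;
SimonStrooker2007 Thm. 2.4, Cor. 2.7; Brochard2017 proof of Thm. 1 (2)] -/
def WiebeCriterion : Prop :=
  ∀ (k : Type u) (R : Type v) [Field k] [CommRing R] [Algebra k R] [IsLocalRing R]
    [IsNoetherianRing R] (n : ℕ) (θ : MvPowerSeries (Fin n) k →ₐ[k] R), Surjective θ →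
    ∀ W : Matrix (Fin n) (Fin n) (MvPowerSeries (Fin n) k),
      (∀ i, θ (∑ j, W i j * MvPowerSeries.X j) = 0) → θ W.det ≠ 0 →
        RingHom.ker θ = Ideal.span (Set.range fun i => ∑ j, W i j * MvPowerSeries.X j) ∧
          (maximalIdeal R).annihilator = Ideal.span {θ W.det}

/-- **B5a (size L; the provable special case variant 6B needs): Wiebe's criterion for ARTINIAN local
`k`-algebras** (`Module.Finite k R`).  Here `ker θ ⊇ 𝔪_X^N`, the lift `W` may be taken polynomial, and the
proof is finite-dimensional: for `N ≫ 0` the perturbed rows `a'ᵢ = aᵢ + Xᵢ^N` cut out a zero-dimensional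
scheme whose component at the origin is a local complete intersection `A'` with socle `det W'` (tree:
`det_notMem_span_sup_span_X_pow`, TateGorensteinField §1/§4); `ker θ · A'` misses the socle, hence is `0`,
so `R = A'`.  No prime avoidance, no Krull. -/
theorem wiebeArtin (k : Type u) (R : Type v) [Field k] [CommRing R] [Algebra k R] [IsLocalRing R]
    [Module.Finite k R] (n : ℕ) (θ : MvPowerSeries (Fin n) k →ₐ[k] R) (hθ : Surjective θ)
    (W : Matrix (Fin n) (Fin n) (MvPowerSeries (Fin n) k))
    (hrel : ∀ i, θ (∑ j, W i j * MvPowerSeries.X j) = 0) (hdet : θ W.det ≠ 0) :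
    RingHom.ker θ = Ideal.span (Set.range fun i => ∑ j, W i j * MvPowerSeries.X j) ∧
      (maximalIdeal R).annihilator = Ideal.span {θ W.det} := by
  sorry

/-- Consistency (PROVED): B5a is the Artinian case of the named fact B5 (a finite `k`-algebra is
Noetherian: `isNoetherian_of_tower` along `k → R`). -/
theorem wiebeArtin_of_wiebeCriterion (h : WiebeCriterion.{u, v}) (k : Type u) (R : Type v) [Field k]
    [CommRing R] [Algebra k R] [IsLocalRing R] [Module.Finite k R] (n : ℕ)
    (θ : MvPowerSeries (Fin n) k →ₐ[k] R) (hθ : Surjective θ)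
    (W : Matrix (Fin n) (Fin n) (MvPowerSeries (Fin n) k))
    (hrel : ∀ i, θ (∑ j, W i j * MvPowerSeries.X j) = 0) (hdet : θ W.det ≠ 0) :
    RingHom.ker θ = Ideal.span (Set.range fun i => ∑ j, W i j * MvPowerSeries.X j) ∧
      (maximalIdeal R).annihilator = Ideal.span {θ W.det} := by
  haveI : IsNoetherianRing R := by
    have : IsNoetherian k R := inferInstance
    exact isNoetherian_of_tower k this
  exact h k R n θ hθ W hrel hdet

/-- **B5b (size S).**  From B5/B5a's presentation to the tree's predicate: `ker θ` generated by `n`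
elements in `k[[X₁,…,X_n]]` gives `IsCompleteIntersectionOver k R`
(`Ideal.quotientKerAlgEquivOfSurjective`). -/
theorem isCompleteIntersectionOver_of_ker_eq_span (k : Type u) (R : Type w) [Field k] [CommRing R]
    [Algebra k R] (n : ℕ) (θ : MvPowerSeries (Fin n) k →ₐ[k] R) (hθ : Surjective θ)
    (a : Fin n → MvPowerSeries (Fin n) k) (hker : RingHom.ker θ = Ideal.span (Set.range a)) :
    IsCIOver k R := by
  sorry

/-! ## §4  Freeness over the fibre from a simple socle (replaces Brochard–Mézard Prop. 6 + flatness
descent; elementary) and the dimension counts -/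

/-- **B6 (size S/M).**  `B` Artinian local with socle generated by ONE element `Δ` killing `𝔪_B`, `M` a
finite `B`-module in which `Δ`-torsion is `𝔪_B`-divisible (`Δ m = 0 ⟹ m ∈ 𝔪_B M`; this is B3 read in
`M̄ = M/J_x M` over `B̄ = B/J_x`).  Then `M` is free: lift a basis `(m̄ⱼ)` of `M/𝔪M`; if `∑ bⱼ mⱼ = 0` with
`I = (bⱼ) ≠ 0`, take `t` maximal with `𝔪^t I ≠ 0` and `c ∈ 𝔪^t` with some `c bⱼ ≠ 0`; all `c bⱼ` lie in the
socle, `c bⱼ = λⱼ Δ`, so `Δ (∑ λⱼ mⱼ) = 0`, so `∑ λⱼ mⱼ ∈ 𝔪M`, so every `λⱼ ∈ 𝔪`, so every `c bⱼ = 0` —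
contradiction.  [replaces Brochard2017 Prop. 6 ([BM] weakly-torsion-free ⇔ flat) in the proof of Thm. 1 (3)] -/
theorem free_of_simple_socle {B M : Type*} [CommRing B] [IsLocalRing B] [IsArtinianRing B]
    [AddCommGroup M] [Module B M] [Module.Finite B M] (Δ : B)
    (hΔ : ∀ c ∈ maximalIdeal B, Δ * c = 0)
    (hsoc : ∀ s : B, (∀ c ∈ maximalIdeal B, s * c = 0) → s ∈ Ideal.span {Δ})
    (hP2 : ∀ m : M, Δ • m = 0 → m ∈ maximalIdeal B • (⊤ : Submodule B M)) :
    Module.Free B M := by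
  sorry

/-- **B7 (size S; dimension count).**  `A → B` finite-dimensional local `k`-algebras, `M ≠ 0` finite,
free over `A` AND free over `B` ⟹ `B` free over `A` (`B` is an `A`-direct summand of `M ≅ B^μ`, which is
`A`-free; projective f.g. over local ⟹ free).  With B6 this gives Brochard Thm. 1 (1)+(3) in the Artinian
case: `T̄_Q` free over `k[Δ_Q]`, `H̄` free over `T̄_Q`.  [Brochard2017, Thm. 9 (1)(2)] -/
theorem free_base_of_free_of_free {A B M : Type*} [CommRing A] [IsLocalRing A] [CommRing B]
    [Algebra A B] [Module.Finite A B] [AddCommGroup M] [Module B M] [Module A M]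
    [IsScalarTower A B M] [Module.Free B M] [Module.Finite B M] [Nontrivial M] [Module.Free A M] :
    Module.Free A B := by
  sorry

/-! ## §5  Variant 6B: fibre generation and the minimal `R = T` modulo `λ` WITHOUT Wiebe for
non-Artinian rings -/

/-- **B8 (size M; "fibre generation", this ideator's lemma).**  `A` Artinian local with minimal generators
`s₁,…,s_r` of `𝔪_A` (`r = edim A`), `B` finite FREE over `A`, `θ : k[[X₁,…,X_r]] ↠ B` a surjection (so
`edim B ≤ r`), `σᵢ` lifts of the `sᵢ`, and the fibre ideal `I₀ = θ⁻¹(𝔪_A B)` generated by `r` elements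
(`B/𝔪_A B` a complete intersection — B5a).  Then `I₀ = (σ₁,…,σ_r)`.  Proof: write `B = A[[X]]/(F)` with
`Fᵢ = fᵢ + ∑ sⱼ Gᵢⱼ + O(s²)` lifting generators `fᵢ` of `I₀` (flatness), `sⱼ - σⱼ = ∑ Hⱼᵢ Fᵢ`; comparing
`s`-constant and `s`-linear parts gives `σ = -h f` and `h G ≡ 1 (mod I₀)`, so `h(0)` is invertible when
`#f = r`, and Nakayama.  (With `#f > r` it FAILS — the CI hypothesis is sharp.) -/
theorem comap_fibre_eq_span_lifts {k A B : Type*} [Field k] [CommRing A] [IsLocalRing A]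
    [IsArtinianRing A] [Algebra k A] [CommRing B] [Algebra k B] [Algebra A B] [IsScalarTower k A B]
    [Module.Free A B] [Module.Finite A B] {r : ℕ} (s : Fin r → A)
    (hspan : Ideal.span (Set.range s) = maximalIdeal A)
    (hmin : ∀ a : Fin r → A, ∑ i, a i * s i = 0 → ∀ i, a i ∈ maximalIdeal A)
    (θ : MvPowerSeries (Fin r) k →ₐ[k] B) (hθ : Surjective θ)
    (σ : Fin r → MvPowerSeries (Fin r) k) (hσ : ∀ i, θ (σ i) = algebraMap A B (s i))
    (hCI : ∃ f : Fin r → MvPowerSeries (Fin r) k,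
      Ideal.span (Set.range f) = ((maximalIdeal A).map (algebraMap A B)).comap θ) :
    ((maximalIdeal A).map (algebraMap A B)).comap θ = Ideal.span (Set.range σ) := by
  sorry

/-- **B9 (size S; assembly modulo `λ`).**  `θR : k[[X₁,…,X_r]] ↠ R̄_Q` (the Selmer bound `edim R̄_Q ≤ #Q`),
`π : R̄_Q ↠ T̄_Q`, `σᵢ` power series mapping to the group-ring generators `sᵢ`; if the fibre ideal of
`θT = π ∘ θR` is `(σ)` (B8), then the kernel of `R̄_Q → T̄_Q/(s) = T̄_∅` is `(s) R̄_Q`, i.e.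
**`R̄_∅ = R̄_Q/(s) ≅ T̄_∅`** — the minimal case of `R = T` modulo `λ`, with no patching.
[Brochard2017, Thm. 9 (4) + Remark 11, mod `λ`] -/
theorem ker_to_fibre_eq_span {k Rb Tb : Type*} [Field k] [CommRing Rb] [CommRing Tb] [Algebra k Rb]
    [Algebra k Tb] {r : ℕ} (θR : MvPowerSeries (Fin r) k →ₐ[k] Rb) (hθR : Surjective θR)
    (π : Rb →ₐ[k] Tb) (σ : Fin r → MvPowerSeries (Fin r) k)
    (hfib : (Ideal.span (Set.range fun i => π (θR (σ i)))).comap (π.comp θR) =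
      Ideal.span (Set.range σ)) :
    RingHom.ker ((Ideal.Quotient.mkₐ k (Ideal.span (Set.range fun i => π (θR (σ i))))).comp π) =
      Ideal.span (Set.range fun i => θR (σ i)) := by
  sorry

/-! ## §6  Lifting from `k` to `O` (Brochard 2017 Lemma 10 (1),(3); complete Nakayama) -/

/-- **B10 (size S; Lemma 10 (1)).**  `O` Noetherian local, `f : M → N` a map of finite `O`-modules with `N`
free; if `f` is an isomorphism modulo `𝔪_O` then `f` is an isomorphism (cokernel by Nakayama; kernel `K`
satisfies `K = 𝔪K` because `N` is flat, then Nakayama).  Used for `R_∅ → T_∅` once `R_∅` is known finite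
(B11).  [Brochard2017, Lemma 10 (1)] -/
theorem bijective_of_bijective_mod_maximalIdeal {O M N : Type*} [CommRing O] [IsLocalRing O]
    [IsNoetherianRing O] [AddCommGroup M] [Module O M] [Module.Finite O M] [AddCommGroup N]
    [Module O N] [Module.Finite O N] [Module.Free O N] (f : M →ₗ[O] N)
    (hsurj : ∀ y : N, ∃ x : M, f x - y ∈ maximalIdeal O • (⊤ : Submodule O N))
    (hinj : ∀ x : M, f x ∈ maximalIdeal O • (⊤ : Submodule O N) →
      x ∈ maximalIdeal O • (⊤ : Submodule O M)) :
    Bijective f := by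
  sorry

/-- **B11 (size S/M; complete Nakayama, Matsumura Thm. 8.4).**  `O` complete local, `R` a complete
Noetherian local `O`-algebra with `𝔪_O R ⊆ 𝔪_R`; if `R/𝔪_O R` is finite over `O` (i.e. `R̄ = R/λ` is
finite-dimensional — which B9 gives for `R_∅`, since `R̄_∅ ≅ T̄_∅`), then `R` is finite over `O`.
[Matsumura1986, Thm. 8.4; Brochard2017, proof of Thm. 9, last sentence] -/
theorem finite_of_finite_fibre {O R : Type*} [CommRing O] [IsLocalRing O]
    [IsAdicComplete (maximalIdeal O) O] [CommRing R] [IsLocalRing R] [IsNoetherianRing R]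
    [IsAdicComplete (maximalIdeal R) R] [Algebra O R]
    (hloc : (maximalIdeal O).map (algebraMap O R) ≤ maximalIdeal R)
    (hfin : Module.Finite O (R ⧸ (maximalIdeal O).map (algebraMap O R))) :
    Module.Finite O R := by
  sorry

/-- **B12 (size M; Lemma 10 (3) with `A = O`).**  `T` a finite free local `O`-algebra whose reduction
`Tk = T/𝔪_O T` is a complete intersection over the residue field `k`; then `T` is a complete intersection
over `O` (lift the `fᵢ` into `ker(O[[X]] → T)`, surjectivity and `K = 𝔪K` by Nakayama against `T` free).
Feeds the `Σ`-step (k2 g7/8: numerical criterion needs `T_∅` CI over `O`).  [Brochard2017, Lemma 10 (3)] -/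
theorem isCompleteIntersectionOver_of_residue {O : Type u} {T : Type w} {k : Type u} {Tk : Type w}
    [CommRing O] [IsLocalRing O] [IsNoetherianRing O] [IsAdicComplete (maximalIdeal O) O]
    [CommRing T] [IsLocalRing T] [Algebra O T] [Module.Finite O T] [Module.Free O T]
    [Field k] [Algebra O k] (hk : Surjective (algebraMap O k))
    (hk' : RingHom.ker (algebraMap O k) = maximalIdeal O)
    [CommRing Tk] [Algebra k Tk] [Algebra O Tk] [IsScalarTower O k Tk]
    (ψ : T →ₐ[O] Tk) (hψ : Surjective ψ)
    (hψ' : RingHom.ker ψ = (maximalIdeal O).map (algebraMap O T))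
    (h : IsCIOver.{u, w} k Tk) : IsCIOver.{u, w} O T := by
  sorry

/-! ## §0  Sanity (PROVED): the toy case of the engine, `n = 1`, `A = k[s]/(s²) → B`, and B4's
contrapositive shape -/

/-- Shape check for the ideal-membership idiom used in B3/B4 (`J_u = Ideal.span (range u)`):
a `u`-multiple lies in `(u)`. -/
example {B : Type*} [CommRing B] (u b : B) : u * b ∈ Ideal.span ({u} : Set B) :=
  Ideal.mul_mem_right _ _ (Ideal.subset_span rfl)

end Summit.ABC.ABC.Cruxes.FreyModularity.StubIdeas1g10

end
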